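import Literature.NumberTheory.CubicFields.NonFundCountShintaniCoeff
import Mathlib.NumberTheory.LSeries.RiemannZeta
import Mathlib.Analysis.SpecialFunctions.Gamma.Basic
import Mathlib.Analysis.Complex.CauchyIntegral
import Literature.NumberTheory.Sieve.SmoothArcLocalFactors
import HarnessLib

/-!
# The analytic continuation and the residues of Shintani's zeta functions `ξ^±(s, Φ_m)` (BTT Thm 2.4; Shintani, Datskovsky–Wright, Taniguchi–Thorne)

Topic `Literature/NumberTheory/CubicFields`; built on `ShintaniZeta.lean` (`shintaniZetaMod Φ sgn = ξ^±(s, Φ_m)`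
as a Dirichlet series) and `NonFundCountShintaniCoeff.lean` (`psiMod q = Ψ_{q²}`, the sieve weight of BTT §5).

Bhargava–Taniguchi–Thorne 2023, Theorem 2.4: "The Shintani zeta functions `ξ^±(s, Φ_m)` converge absolutely
for `Re(s) > 1`, have analytic continuation to all of `ℂ`, are holomorphic except for simple poles at `s = 1`
and `s = 5/6`, and satisfy the functional equation (eq:FE) … The residues are given by
`Res_{s=1} ξ^±(s, Φ_m) = α^± 𝒜(Φ_m) + β ℬ(Φ_m)` and `Res_{s=5/6} ξ^±(s, Φ_m) = γ^± 𝒞(Φ_m)` (13), where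
`α⁺ = π²/72, α⁻ = π²/24, β = π²/24, γ⁺ = π² ζ(1/3)/(9 Γ(2/3)³), γ⁻ = √3 γ⁺`, and for
`Φ_m = ⊗_{p^a ∥ m} Φ_{p^a}` the functionals `𝒜, ℬ, 𝒞` are multiplicative (14), with … (eq:res_p2)
`𝒜(Φ_{p²}) = ℬ(Φ_{p²}) = 2p⁻² − p⁻⁴`, `𝒞(Φ_{p²}) = p^{-5/3} + 2p⁻² − p^{-8/3} − p⁻³` for the characteristic
function `Φ_{p²}` of [the `x` nonmaximal at `p` or with a triple root mod `p`; for `p > 2`, those with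
`p² ∣ Disc(x)` (§5)] … stated in this form in Propositions 8.15 … of [TT_L]."
(Taniguchi–Thorne, *Orbital L-functions*, Cor. 8.15, for their `Φ'_p` = "nonmaximal or totally ramified at
`p`", every prime `p`, together with Prop. 8.6 (the residues `𝒜α + ℬβ`, `𝒞 ζ(1/3) γ`) and Thm 8.4 (Shintani:
`Res_{s=1} ξ = α + β`, `Res_{5/6} ξ = ζ(1/3) γ`); BTT's constants are half of TT_L's, `GL₂(ℤ)`- versus
`SL₂(ℤ)`-orbits.)

This file
* DEFINES the constants `shintaniAlpha sgn = α^±`, `shintaniBeta = β`, `shintaniGamma sgn = γ^±`;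
* DEFINES the continuation as an honest object: `IsShintaniEntire Φ sgn Λ` says that `Λ` is an entire function
  with `Λ(s) = (s − 1)(s − 5/6) ξ^{sgn}(s, Φ)` on `Re s > 1`; such a `Λ` is unique (`IsShintaniEntire.unique`, the
  identity theorem), `shintaniEntire Φ sgn` is it (or `0` if there is none), and
  `shintaniRes1 Φ sgn := 6 Λ(1) = Res_{s=1} ξ^{sgn}(s, Φ)`, `shintaniRes56 Φ sgn := −6 Λ(5/6) = Res_{s=5/6} ξ^{sgn}(s, Φ)`;
* DEFINES the local factors `resFactor1 q = ∏_{p ∣ q} (2p⁻² − p⁻⁴)`, `resFactor56 q = ∏_{p ∣ q} (p^{-5/3} + 2p⁻² − p^{-8/3} − p⁻³)`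
  with `q⁻² ≤ resFactor1 q ≤ 2^{ω(q)} q⁻²`, `|resFactor56 q| ≤ 4^{ω(q)} q^{-5/3}` for squarefree `q`;
* and SPELLS OUT, as the hypothesis schema `HasPsiResidues q sgn` (a `Prop`-valued structure with parameters,
  consumed as `∀ q squarefree, ∀ sgn = ±1, HasPsiResidues q sgn` by the glue file; nothing is asserted), the part
  of Theorem 2.4 that the direct proof of BTT (3) (§5, `M = 1`, `Σ_p = A'_p`) uses: `ξ^±(s, Ψ_{q²})`
  (`= shintaniZetaMod (psiMod q) (±1)`, level `16q²`, the pull-back of `⊗_{p ∣ q} Φ'_p`) has such an entire `Λ`,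
  with `Res_{s=1} = (α^± + β) ∏_{p∣q} (2p⁻² − p⁻⁴)` and `Res_{s=5/6} = γ^± ∏_{p∣q} (p^{-5/3} + 2p⁻² − p^{-8/3} − p⁻³)`
  ((13) + (14) + (eq:res_p2); the functionals `𝒜, ℬ, 𝒞` of a pull-back are those of the function — in TT_L
  (8.2) they are integrals of the locally constant function on `V(ℤ_p)`).
  Not here: the functional equation (eq:FE) with the dual zeta function, and the residues of a general
  `GL₂(ℤ/mℤ)`-invariant `Φ_m` (TT_L Prop. 8.6: `𝒜_N, ℬ_N, 𝒞_N` as adelic integrals).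

## References

* M. Bhargava, T. Taniguchi, F. Thorne, *Improved error estimates for the Davenport–Heilbronn theorems*,
  Math. Ann. 389 (2024) = arXiv:2107.12819, Thm 2.4, (13), (14), (eq:res_p2), §5 [BhargavaTaniguchiThorne2023].
* T. Taniguchi, F. Thorne, *Orbital L-functions for the space of binary cubic forms*, Canad. J. Math. 65 (2013),
  Def. 5.10 (`Φ'_p`), Def. 8.3, Thm 8.4, Prop. 8.6, Cor. 8.15 [TaniguchiThorne2013orbital].
* T. Shintani, *On Dirichlet series whose coefficients are class numbers of integral binary cubic forms*,
  J. Math. Soc. Japan 24 (1972), Thm 2 / Thm 4 [Shintani1972].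
-/

noncomputable section

open Complex Set Filter Topology
open Literature.NumberTheory.Sieve.SmoothArcs (rpow_of_squarefree)

namespace Literature.NumberTheory.CubicFields

/-! ### The constants `α^±, β, γ^±` of (13) -/

/-- `α⁺ = π²/72`, `α⁻ = π²/24` (BTT (13); `sgn = 1` is `+`, anything else is read as `−`). [cite: BhargavaTaniguchiThorne2023, Thm 2.4 (13) (α^±)] -/
def shintaniAlpha (sgn : ℤ) : ℝ :=
  if sgn = 1 then Real.pi ^ 2 / 72 else Real.pi ^ 2 / 24

/-- `β = π²/24` (BTT (13)). [cite: BhargavaTaniguchiThorne2023, Thm 2.4 (13) (β)] -/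
def shintaniBeta : ℝ :=
  Real.pi ^ 2 / 24

/-- `γ⁺ = π² ζ(1/3) / (9 Γ(2/3)³)`, `γ⁻ = √3 γ⁺` (BTT (13); `ζ(1/3) = riemannZeta (1/3)`, a real number). [cite: BhargavaTaniguchiThorne2023, Thm 2.4 (13) (γ^±)] -/
def shintaniGamma (sgn : ℤ) : ℝ :=
  (if sgn = 1 then 1 else Real.sqrt 3) * (Real.pi ^ 2 * (riemannZeta (1 / 3)).re / (9 * Real.Gamma (2 / 3) ^ 3))

/-- `α⁺ = π²/72`. [folklore] -/
theorem shintaniAlpha_one : shintaniAlpha 1 = Real.pi ^ 2 / 72 := by simp [shintaniAlpha]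

/-- `α⁻ = π²/24`. [folklore] -/
theorem shintaniAlpha_neg_one : shintaniAlpha (-1) = Real.pi ^ 2 / 24 := by simp [shintaniAlpha]

/-- `α^± > 0`. [folklore] -/
theorem shintaniAlpha_pos (sgn : ℤ) : 0 < shintaniAlpha sgn := by
  unfold shintaniAlpha; split_ifs <;> positivity

/-- `β > 0`. [folklore] -/
theorem shintaniBeta_pos : 0 < shintaniBeta := by
  unfold shintaniBeta; positivity

/-- `α⁺ + β = π²/18`. [folklore] -/
theorem shintaniAlpha_one_add_beta : shintaniAlpha 1 + shintaniBeta = Real.pi ^ 2 / 18 := by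
  rw [shintaniAlpha_one, shintaniBeta]; ring

/-- `α⁻ + β = π²/12`. [folklore] -/
theorem shintaniAlpha_neg_one_add_beta : shintaniAlpha (-1) + shintaniBeta = Real.pi ^ 2 / 12 := by
  rw [shintaniAlpha_neg_one, shintaniBeta]; ring

/-! ### The analytic continuation `Λ^±(s, Φ) = (s − 1)(s − 5/6) ξ^±(s, Φ)` and the residues -/

variable {m : ℕ}

/-- **"`ξ^{sgn}(s, Φ)` has analytic continuation to `ℂ`, holomorphic except for (at most) simple poles at `s = 1`
and `s = 5/6`", witnessed by `Λ`**: `Λ` is entire and `Λ(s) = (s − 1)(s − 5/6) · ξ^{sgn}(s, Φ)` on the half-plane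
`Re s > 1` of absolute convergence. [cite: BhargavaTaniguchiThorne2023, Thm 2.4 (analytic continuation, simple poles at 1 and 5/6)] -/
def IsShintaniEntire (Φ : BinaryCubic (ZMod m) → ℂ) (sgn : ℤ) (Λ : ℂ → ℂ) : Prop :=
  Differentiable ℂ Λ ∧ ∀ s : ℂ, 1 < s.re → Λ s = (s - 1) * (s - 5 / 6) * shintaniZetaMod Φ sgn s

/-- **The continuation is unique** (identity theorem: two entire functions agreeing on the open half-plane
`Re s > 1` agree everywhere). [folklore] -/
theorem IsShintaniEntire.unique {Φ : BinaryCubic (ZMod m) → ℂ} {sgn : ℤ} {Λ₁ Λ₂ : ℂ → ℂ}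
    (h₁ : IsShintaniEntire Φ sgn Λ₁) (h₂ : IsShintaniEntire Φ sgn Λ₂) : Λ₁ = Λ₂ := by
  have hA1 : AnalyticOnNhd ℂ Λ₁ univ := Complex.analyticOnNhd_univ_iff_differentiable.mpr h₁.1
  have hA2 : AnalyticOnNhd ℂ Λ₂ univ := Complex.analyticOnNhd_univ_iff_differentiable.mpr h₂.1
  have hev : Λ₁ =ᶠ[𝓝 (2 : ℂ)] Λ₂ := by
    filter_upwards [(isOpen_lt continuous_const Complex.continuous_re).mem_nhds
      (show (2 : ℂ) ∈ {s : ℂ | 1 < s.re} by simp)] with s hs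
    rw [h₁.2 s hs, h₂.2 s hs]
  funext z
  exact hA1.eqOn_of_preconnected_of_eventuallyEq hA2 isPreconnected_univ (mem_univ 2) hev (mem_univ z)

open Classical in
/-- **`Λ^{sgn}(·, Φ)`**: the entire continuation of `(s − 1)(s − 5/6) ξ^{sgn}(s, Φ)` when it exists (it does,
BTT Thm 2.4), and `0` otherwise. [cite: BhargavaTaniguchiThorne2023, Thm 2.4 (the analytic continuation of ξ^±(s, Φ_m))] -/
def shintaniEntire (Φ : BinaryCubic (ZMod m) → ℂ) (sgn : ℤ) : ℂ → ℂ :=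
  if h : ∃ Λ : ℂ → ℂ, IsShintaniEntire Φ sgn Λ then h.choose else 0

/-- When a continuation exists, `shintaniEntire` is one. [folklore] -/
theorem isShintaniEntire_shintaniEntire {Φ : BinaryCubic (ZMod m) → ℂ} {sgn : ℤ}
    (h : ∃ Λ : ℂ → ℂ, IsShintaniEntire Φ sgn Λ) : IsShintaniEntire Φ sgn (shintaniEntire Φ sgn) := by
  classical
  rw [shintaniEntire, dif_pos h]
  exact h.choose_spec

/-- … and it is THE continuation: any witness equals `shintaniEntire`. [folklore] -/
theorem IsShintaniEntire.shintaniEntire_eq {Φ : BinaryCubic (ZMod m) → ℂ} {sgn : ℤ} {Λ : ℂ → ℂ}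
    (h : IsShintaniEntire Φ sgn Λ) : shintaniEntire Φ sgn = Λ :=
  (isShintaniEntire_shintaniEntire ⟨Λ, h⟩).unique h

/-- On `Re s > 1` the continuation is `(s − 1)(s − 5/6) ξ^{sgn}(s, Φ)`. [folklore] -/
theorem shintaniEntire_apply_of_one_lt_re {Φ : BinaryCubic (ZMod m) → ℂ} {sgn : ℤ}
    (h : ∃ Λ : ℂ → ℂ, IsShintaniEntire Φ sgn Λ) {s : ℂ} (hs : 1 < s.re) :
    shintaniEntire Φ sgn s = (s - 1) * (s - 5 / 6) * shintaniZetaMod Φ sgn s :=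
  (isShintaniEntire_shintaniEntire h).2 s hs

/-- **`Res_{s=1} ξ^{sgn}(s, Φ) = Λ(1)/(1 − 5/6) = 6 Λ(1)`.** [cite: BhargavaTaniguchiThorne2023, Thm 2.4 (13) (Res_{s=1} ξ^±(s, Φ_m))] -/
def shintaniRes1 (Φ : BinaryCubic (ZMod m) → ℂ) (sgn : ℤ) : ℂ :=
  6 * shintaniEntire Φ sgn 1

/-- **`Res_{s=5/6} ξ^{sgn}(s, Φ) = Λ(5/6)/(5/6 − 1) = −6 Λ(5/6)`.** [cite: BhargavaTaniguchiThorne2023, Thm 2.4 (13) (Res_{s=5/6} ξ^±(s, Φ_m))] -/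
def shintaniRes56 (Φ : BinaryCubic (ZMod m) → ℂ) (sgn : ℤ) : ℂ :=
  -6 * shintaniEntire Φ sgn (5 / 6)

/-- The meaning of `shintaniRes1`: near `s = 1` (indeed on all of `Re s > 1`),
`ξ^{sgn}(s, Φ) = Λ(s) / ((s − 1)(s − 5/6))` with `Λ` entire, so the residue at the simple pole `s = 1` is
`Λ(1)/(1/6)`. [folklore] -/
theorem shintaniZetaMod_eq_div {Φ : BinaryCubic (ZMod m) → ℂ} {sgn : ℤ}
    (h : ∃ Λ : ℂ → ℂ, IsShintaniEntire Φ sgn Λ) {s : ℂ} (hs : 1 < s.re) :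
    shintaniZetaMod Φ sgn s = shintaniEntire Φ sgn s / ((s - 1) * (s - 5 / 6)) := by
  have h1 : s - 1 ≠ 0 := by
    intro h0; have := congrArg Complex.re h0; simp at this; linarith
  have h2 : s - 5 / 6 ≠ 0 := by
    intro h0; have := congrArg Complex.re h0; norm_num at this; linarith
  rw [eq_div_iff (mul_ne_zero h1 h2), shintaniEntire_apply_of_one_lt_re h hs]
  ring

/-! ### The local factors of (eq:res_p2) -/

/-- `∏_{p ∣ q} 𝒜(Φ'_p) = ∏_{p ∣ q} (2p⁻² − p⁻⁴)` (`= ∏ ℬ(Φ'_p)`), (eq:res_p2) with (14). [cite: BhargavaTaniguchiThorne2023, Thm 2.4 (eq:res_p2) (𝒜 = ℬ = 2p⁻² − p⁻⁴)] -/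
def resFactor1 (q : ℕ) : ℝ :=
  ∏ p ∈ q.primeFactors, (2 * (p : ℝ) ^ (-2 : ℝ) - (p : ℝ) ^ (-4 : ℝ))

/-- `∏_{p ∣ q} 𝒞(Φ'_p) = ∏_{p ∣ q} (p^{-5/3} + 2p⁻² − p^{-8/3} − p⁻³)`, (eq:res_p2) with (14). [cite: BhargavaTaniguchiThorne2023, Thm 2.4 (eq:res_p2) (𝒞 = p^{-5/3} + 2p^{-2} − p^{-8/3} − p^{-3})] -/
def resFactor56 (q : ℕ) : ℝ :=
  ∏ p ∈ q.primeFactors,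
    ((p : ℝ) ^ (-(5 : ℝ) / 3) + 2 * (p : ℝ) ^ (-2 : ℝ) - (p : ℝ) ^ (-(8 : ℝ) / 3) - (p : ℝ) ^ (-3 : ℝ))

/-- Empty product at `q = 1`. [folklore] -/
theorem resFactor1_one : resFactor1 1 = 1 := by simp [resFactor1]

/-- Empty product at `q = 1`. [folklore] -/
theorem resFactor56_one : resFactor56 1 = 1 := by simp [resFactor56]

/-- `p⁻² ≤ 2p⁻² − p⁻⁴ ≤ 2 p⁻²` for a prime `p`. [folklore] -/
theorem rpow_neg_two_le_factor1 {p : ℕ} (hp : p.Prime) :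
    (p : ℝ) ^ (-2 : ℝ) ≤ 2 * (p : ℝ) ^ (-2 : ℝ) - (p : ℝ) ^ (-4 : ℝ) ∧
      2 * (p : ℝ) ^ (-2 : ℝ) - (p : ℝ) ^ (-4 : ℝ) ≤ 2 * (p : ℝ) ^ (-2 : ℝ) := by
  have hp1 : (1 : ℝ) < p := by exact_mod_cast hp.one_lt
  have hp0 : (0 : ℝ) < p := by positivity
  have h4 : (p : ℝ) ^ (-4 : ℝ) = (p : ℝ) ^ (-2 : ℝ) * (p : ℝ) ^ (-2 : ℝ) := by
    rw [← Real.rpow_add hp0]; norm_num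
  have h2le : (p : ℝ) ^ (-2 : ℝ) ≤ 1 := Real.rpow_le_one_of_one_le_of_nonpos hp1.le (by norm_num)
  have h2pos : 0 < (p : ℝ) ^ (-2 : ℝ) := Real.rpow_pos_of_pos hp0 _
  constructor
  · rw [h4]; nlinarith
  · have : 0 ≤ (p : ℝ) ^ (-4 : ℝ) := Real.rpow_nonneg hp0.le _
    linarith

/-- **`q⁻² ≤ ∏_{p∣q} (2p⁻² − p⁻⁴)` for squarefree `q`** (`q = ∏_{p ∣ q} p`). [folklore] -/
theorem rpow_neg_two_le_resFactor1 {q : ℕ} (hq : Squarefree q) : (q : ℝ) ^ (-2 : ℝ) ≤ resFactor1 q := by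
  rw [rpow_of_squarefree hq _, resFactor1]
  refine Finset.prod_le_prod (fun p _ => by positivity) fun p hp => ?_
  exact (rpow_neg_two_le_factor1 (Nat.prime_of_mem_primeFactors hp)).1

/-- `0 < ∏_{p∣q} (2p⁻² − p⁻⁴)`. [folklore] -/
theorem resFactor1_pos (q : ℕ) : 0 < resFactor1 q := by
  unfold resFactor1
  refine Finset.prod_pos fun p hp => ?_
  have hpr := Nat.prime_of_mem_primeFactors hp
  have h := (rpow_neg_two_le_factor1 hpr).1
  exact lt_of_lt_of_le (Real.rpow_pos_of_pos (by exact_mod_cast hpr.pos) _) h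

/-- **`∏_{p∣q} (2p⁻² − p⁻⁴) ≤ 2^{ω(q)} q⁻²` for squarefree `q`.** [folklore] -/
theorem resFactor1_le {q : ℕ} (hq : Squarefree q) :
    resFactor1 q ≤ (2 : ℝ) ^ q.primeFactors.card * (q : ℝ) ^ (-2 : ℝ) := by
  rw [rpow_of_squarefree hq _, resFactor1, Finset.pow_card_mul_prod]
  refine Finset.prod_le_prod (fun p hp => ?_) fun p hp => (rpow_neg_two_le_factor1 (Nat.prime_of_mem_primeFactors hp)).2
  have hpr := Nat.prime_of_mem_primeFactors hp
  exact le_trans (Real.rpow_nonneg (by positivity) _) (rpow_neg_two_le_factor1 hpr).1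

/-- `|p^{-5/3} + 2p⁻² − p^{-8/3} − p⁻³| ≤ 4 p^{-5/3}` for a prime `p` (each of the four terms is at most `p^{-5/3}`). [folklore] -/
theorem abs_factor56_le {p : ℕ} (hp : p.Prime) :
    |(p : ℝ) ^ (-(5 : ℝ) / 3) + 2 * (p : ℝ) ^ (-2 : ℝ) - (p : ℝ) ^ (-(8 : ℝ) / 3) - (p : ℝ) ^ (-3 : ℝ)|
      ≤ 4 * (p : ℝ) ^ (-(5 : ℝ) / 3) := by
  have hp1 : (1 : ℝ) ≤ p := by exact_mod_cast hp.one_lt.le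
  have hp0 : (0 : ℝ) < p := by positivity
  have hle : ∀ e : ℝ, e ≤ -(5 : ℝ) / 3 → (p : ℝ) ^ e ≤ (p : ℝ) ^ (-(5 : ℝ) / 3) := fun e he =>
    Real.rpow_le_rpow_of_exponent_le hp1 he
  have h2 := hle (-2) (by norm_num)
  have h83 := hle (-(8 : ℝ) / 3) (by norm_num)
  have h3 := hle (-3) (by norm_num)
  have n2 : 0 ≤ (p : ℝ) ^ (-2 : ℝ) := Real.rpow_nonneg hp0.le _
  have n83 : 0 ≤ (p : ℝ) ^ (-(8 : ℝ) / 3) := Real.rpow_nonneg hp0.le _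
  have n3 : 0 ≤ (p : ℝ) ^ (-3 : ℝ) := Real.rpow_nonneg hp0.le _
  have n53 : 0 ≤ (p : ℝ) ^ (-(5 : ℝ) / 3) := Real.rpow_nonneg hp0.le _
  rw [abs_le]
  constructor <;> nlinarith

/-- **`|∏_{p∣q} (p^{-5/3} + 2p⁻² − p^{-8/3} − p⁻³)| ≤ 4^{ω(q)} q^{-5/3}` for squarefree `q`.** [folklore] -/
theorem abs_resFactor56_le {q : ℕ} (hq : Squarefree q) :
    |resFactor56 q| ≤ (4 : ℝ) ^ q.primeFactors.card * (q : ℝ) ^ (-(5 : ℝ) / 3) := by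
  rw [rpow_of_squarefree hq _, resFactor56, Finset.abs_prod, Finset.pow_card_mul_prod]
  exact Finset.prod_le_prod (fun p _ => abs_nonneg _) fun p hp => abs_factor56_le (Nat.prime_of_mem_primeFactors hp)

/-! ### Theorem 2.4 with (13), (14), (eq:res_p2) for the sieve weights `Ψ_{q²}`, as a hypothesis schema -/

/-- **The content of Bhargava–Taniguchi–Thorne 2023, Theorem 2.4 with (13), (14) and (eq:res_p2), at one
squarefree `q` and one sign** — a HYPOTHESIS SCHEMA (a `Prop`-valued structure with parameters; the glue
`FundCubicFieldCountShintaniInput.lean` consumes `∀ q squarefree, ∀ sgn = ±1, HasPsiResidues q sgn`; nothing is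
asserted here, and this seat may not vendor the closed statement as a named fact): for `Φ = Ψ_{q²}` (the
characteristic function of the `x` that are, at every `p ∣ q`, nonmaximal or with a triple root mod `p` — the second
definition of §5, `Σ_p = A'_p`; in the tree `psiMod q : V(ℤ/16q²ℤ) → {0, 1}`, the pull-back of `⊗_{p∣q} Φ'_p`,
`NonFundCountShintaniCoeff.lean`), "the Shintani zeta function `ξ^±(s, Ψ_{q²})` [converges absolutely for `Re s > 1`
and] has analytic continuation to all of `ℂ`, holomorphic except for simple poles at `s = 1` and `s = 5/6`" — i.e.
`(s − 1)(s − 5/6) ξ^±(s, Ψ_{q²})` is the restriction to `Re s > 1` of an entire function (`exists_entire`) — "with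
`Res_{s=1} ξ^±(s, Ψ_{q²}) = α^± 𝒜(Ψ_{q²}) + β ℬ(Ψ_{q²}) = (α^± + β) ∏_{p∣q} (2p⁻² − p⁻⁴)`" (`shintaniRes1_eq`) "and
`Res_{s=5/6} ξ^±(s, Ψ_{q²}) = γ^± 𝒞(Ψ_{q²}) = γ^± ∏_{p∣q} (p^{-5/3} + 2p⁻² − p^{-8/3} − p⁻³)`" (`shintaniRes56_eq`)
((13): `α⁺ = π²/72, α⁻ = π²/24, β = π²/24, γ⁺ = π² ζ(1/3)/(9Γ(2/3)³), γ⁻ = √3 γ⁺`; (14): multiplicativity, the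
functionals of a pull-back being those of the function; (eq:res_p2) = Taniguchi–Thorne, *Orbital L-functions*,
Cor. 8.15 for `Φ'_p`, all primes `p`, with Prop. 8.6 and Thm 8.4). Here `Res_{s=1} = shintaniRes1 = 6Λ(1)` and
`Res_{s=5/6} = shintaniRes56 = −6Λ(5/6)` for the entire `Λ(s) = (s − 1)(s − 5/6) ξ^±(s, Ψ_{q²})` (`shintaniEntire`).
The Sato–Shintani theory of the prehomogeneous vector space of binary cubic forms behind Theorem 2.4 (Shintani 1972;
Datskovsky–Wright 1986; F. Sato 1989; TT_L §§4–8) is not in Mathlib.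
[cite: BhargavaTaniguchiThorne2023, Thm 2.4 with (13), (14), (eq:res_p2) (for Ψ_{q²} of §5, Σ_p = A'_p)] -/
structure HasPsiResidues (q : ℕ) (sgn : ℤ) : Prop where
  /-- analytic continuation with at most simple poles at `1` and `5/6` -/
  exists_entire : ∃ Λ : ℂ → ℂ, IsShintaniEntire (psiMod q) sgn Λ
  /-- (13) + (14) + (eq:res_p2) at `s = 1` -/
  shintaniRes1_eq : shintaniRes1 (psiMod q) sgn = (((shintaniAlpha sgn + shintaniBeta) * resFactor1 q : ℝ) : ℂ)
  /-- (13) + (14) + (eq:res_p2) at `s = 5/6` -/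
  shintaniRes56_eq : shintaniRes56 (psiMod q) sgn = ((shintaniGamma sgn * resFactor56 q : ℝ) : ℂ)

namespace HasPsiResidues

variable {q : ℕ} {sgn : ℤ}

/-- The residue at `s = 1` is the positive real number `(α^{sgn} + β) · ∏_{p∣q}(2p⁻² − p⁻⁴)`. [folklore] -/
theorem re_shintaniRes1 (h : HasPsiResidues q sgn) :
    (shintaniRes1 (psiMod q) sgn).re = (shintaniAlpha sgn + shintaniBeta) * resFactor1 q := by
  rw [h.shintaniRes1_eq, Complex.ofReal_re]

/-- … which is at least `(α^{sgn} + β) q⁻²` for squarefree `q` ((13) + (eq:res_p2): `δ₁(Ψ_{q²}) ≫ q⁻²`). [folklore] -/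
theorem le_re_shintaniRes1 (h : HasPsiResidues q sgn) (hq : Squarefree q) :
    (shintaniAlpha sgn + shintaniBeta) * (q : ℝ) ^ (-2 : ℝ) ≤ (shintaniRes1 (psiMod q) sgn).re := by
  rw [h.re_shintaniRes1]
  exact mul_le_mul_of_nonneg_left (rpow_neg_two_le_resFactor1 hq)
    (add_pos (shintaniAlpha_pos sgn) shintaniBeta_pos).le

/-- `‖Res_{s=1}‖ = Res_{s=1}` (it is a positive real). [folklore] -/
theorem norm_shintaniRes1 (h : HasPsiResidues q sgn) :
    ‖shintaniRes1 (psiMod q) sgn‖ = (shintaniAlpha sgn + shintaniBeta) * resFactor1 q := by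
  rw [h.shintaniRes1_eq, Complex.norm_real, Real.norm_eq_abs, abs_of_pos]
  exact mul_pos (add_pos (shintaniAlpha_pos sgn) shintaniBeta_pos) (resFactor1_pos q)

/-- `‖Res_{s=5/6}‖ = |γ^{sgn}| · |∏_{p∣q} 𝒞(Φ'_p)|`. [folklore] -/
theorem norm_shintaniRes56 (h : HasPsiResidues q sgn) :
    ‖shintaniRes56 (psiMod q) sgn‖ = |shintaniGamma sgn * resFactor56 q| := by
  rw [h.shintaniRes56_eq, Complex.norm_real, Real.norm_eq_abs]

/-- On `Re s > 1`: `ξ^{sgn}(s, Ψ_{q²}) = Λ(s)/((s − 1)(s − 5/6))` with `Λ = shintaniEntire (psiMod q) sgn` entire. [folklore] -/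
theorem shintaniZetaMod_eq (h : HasPsiResidues q sgn) {s : ℂ} (hs : 1 < s.re) :
    shintaniZetaMod (psiMod q) sgn s = shintaniEntire (psiMod q) sgn s / ((s - 1) * (s - 5 / 6)) :=
  shintaniZetaMod_eq_div h.exists_entire hs

end HasPsiResidues

/-! ### `q = 1`: Shintani's theorem itself -/

/-- `Ψ_{1} = 1`: with no prime to sieve, the weight is the constant `1` (on `V(ℤ/16ℤ)`). [folklore] -/
theorem psiMod_one (x : BinaryCubic (ZMod (16 * 1 ^ 2))) : psiMod 1 x = 1 := by
  unfold psiMod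
  rw [if_pos]
  intro p hp
  simp [Nat.primeFactors_one] at hp

/-- Hence `ξ^±(s, Ψ_1) = ξ^±(s)`, Shintani's original zeta function (BTT (11)). [folklore] -/
theorem shintaniZetaMod_psiMod_one (sgn : ℤ) : shintaniZetaMod (psiMod 1) sgn = shintaniZeta sgn := by
  have h : psiMod 1 = fun _ => (1 : ℂ) := funext psiMod_one
  rw [h, shintaniZetaMod_one]

/-- **At `q = 1` the schema is Shintani's theorem** (BTT Thm 2.4 at `m = 1`; Taniguchi–Thorne Thm 8.4 halved for
`GL₂(ℤ)`-orbits): `ξ^±(s)` continues with simple poles at `1, 5/6` only, `Res_{s=1} ξ^± = α^± + β`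
(`= π²/18` resp. `π²/12`) and `Res_{s=5/6} ξ^± = γ^±`. [cite: Shintani1972, Thm 2 & Thm 4 (via TaniguchiThorne2013orbital Thm 8.4; BhargavaTaniguchiThorne2023 (13))] -/
theorem HasPsiResidues.one_iff (sgn : ℤ) :
    HasPsiResidues 1 sgn ↔
      (∃ Λ : ℂ → ℂ, Differentiable ℂ Λ ∧ ∀ s : ℂ, 1 < s.re → Λ s = (s - 1) * (s - 5 / 6) * shintaniZeta sgn s) ∧
        shintaniRes1 (psiMod 1) sgn = ((shintaniAlpha sgn + shintaniBeta : ℝ) : ℂ) ∧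
        shintaniRes56 (psiMod 1) sgn = ((shintaniGamma sgn : ℝ) : ℂ) := by
  have hE : ∀ Λ : ℂ → ℂ, IsShintaniEntire (psiMod 1) sgn Λ ↔
      (Differentiable ℂ Λ ∧ ∀ s : ℂ, 1 < s.re → Λ s = (s - 1) * (s - 5 / 6) * shintaniZeta sgn s) := by
    intro Λ; rw [IsShintaniEntire, shintaniZetaMod_psiMod_one]
  constructor
  · rintro ⟨⟨Λ, hΛ⟩, h1, h56⟩
    exact ⟨⟨Λ, (hE Λ).mp hΛ⟩, by simpa [resFactor1_one] using h1, by simpa [resFactor56_one] using h56⟩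
  · rintro ⟨⟨Λ, hΛ⟩, h1, h56⟩
    exact ⟨⟨Λ, (hE Λ).mpr hΛ⟩, by simpa [resFactor1_one] using h1, by simpa [resFactor56_one] using h56⟩

end Literature.NumberTheory.CubicFields

end
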